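import Mathlib.Algebra.BigOperators.Group.Finset.Basic
import Mathlib.Algebra.BigOperators.Pi
import Mathlib.Algebra.Group.Pi.Basic
import Mathlib.Algebra.Order.BigOperators.Group.Finset
import Mathlib.Tactic.Abel
import Mathlib.Tactic.Ring
import Mathlib.Tactic.Linarith
import HarnessLib

/-!
# Venture HSemireg — the Künneth DEGREE LAW of an HPL tree word (the bookkeeping behind LOOP-DEG)

Elementary bookkeeping behind §1 (i) of `widen/W1/ARITYLAW-w1aut1.md` and the soundness of the
LOOP-DEG / tri-degree sieve of the computation cell `pub-hsemireg` (seats w1-cx-2 `W1CX2-LOOPDEG`,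
w1-tw-2 `ldx2`, w1-aut-1 `loopdeg_char` / `arith_minlen`; TABLE-W1 rows W1CX-20·B, W1TW-19/22,
W1AUT-29–32). There, a first-order cancelling word with `N` leaves is evaluated by the homological-
perturbation formula for `m_N`: a sum over planar binary trees whose `N − 1` internal nodes are
PRODUCTS, whose `N − 2` internal edges carry the HOMOTOPY `h`, with the projection `p` at the root.
On the product anchor `A = S₀ × S₁ × S₂` everything is multi-graded by the Künneth slot degrees:
a leaf `ℓᵢ ∈ Ext^{aᵢ}` carries slot degrees `t_{i,k}` with `∑ₖ t_{i,k} = aᵢ`; PRODUCTS ADD slot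
degrees; `h` LOWERS the degree by one IN ONE SLOT; `p` and the harmonic projections preserve them.
Hence the output lands in slot degrees `cₖ = Dₖ − nₖ`, `Dₖ := ∑ᵢ t_{i,k}`, `nₖ :=` the number of
homotopies acting in slot `k` — so `cₖ ≤ Dₖ` (DEGREE AVAILABILITY, the LOOP-DEG test) and
`∑ₖ nₖ = N − 2`, whence `∑ₖ cₖ = ∑ᵢ aᵢ − (N − 2)`; for a loop word (`∑ᵢ aᵢ = N`: the offsets
return along a closed walk) the output has total degree `2` — it lies in
`H²(𝒪_A) = ⊕_{|c| = 2} H^c`, as it must.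

What is recorded, on an inductive type `HTree` of SLOT-LABELLED HPL TREES (a leaf carries its
slot-degree vector, valued in `ℤ` so that lowering is subtraction; an internal node is the product
of two subtrees, each entering either bare — edge label `none` — or through one homotopy labelled
by the slot it acts in — edge label `some k`):

* `HTree.deg_eq` — **degree law**: `deg T = leafSum T − hVec T` (output slot degrees = sum of
  the leaves' slot degrees minus the number of homotopies per slot);
* `HTree.deg_le_leafSum` — **degree availability**: `deg T k ≤ leafSum T k` in every slot;
* `HTree.hCount_add_two` — in a FULL HPL tree (`full`: a subtree enters its parent through a
  homotopy iff it is not a leaf — the shape of the trees in the `m_N` formula) with `N ≥ 2` leaves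
  the homotopies number `N − 2` (`hCount T + 2 = leaves T`; via `inner T + 1 = leaves T` and
  `hCount T + 1 = inner T`);
* `HTree.totalDeg_eq` — **total degree**: `∑ₖ deg T k = ∑ₖ leafSum T k − (N − 2)` for a full
  tree; `HTree.totalDeg_eq_two_of_loop` — if the leaves' degrees add up to `N`, the output has
  total degree `2`.

HONEST FRAMING. Structural induction on finite trees and integer arithmetic only; the Lean index
of the grading bookkeeping of a NECESSARY-condition sieve used by the cell. No curve, sheaf,
complex, `A∞`-structure or semiregularity map is constructed — «products add degrees, `h` lowers
one slot degree by one» enters as the DEFINITION of `deg`; nothing here says that HC, HC_CM or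
HC_AV holds, and nothing here is a new case of anything.
-/

namespace Summit.Ventures.HSemireg

namespace KunnethDegreeLaw

open Finset

/-- Slot-labelled HPL trees over a slot type `κ`: `leaf t` carries the Künneth slot-degree vector
`t` of a leaf; `node l hl r hr` is the PRODUCT of the subtrees `l` and `r`, the edge label
`hl = some k` meaning that `l` enters through a homotopy acting in slot `k`, `hl = none` that it
enters bare. -/
inductive HTree (κ : Type*) : Type _
  | leaf (t : κ → ℤ) : HTree κ
  | node (l : HTree κ) (hl : Option κ) (r : HTree κ) (hr : Option κ) : HTree κ

namespace HTree

variable {κ : Type*}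

/-- Number of homotopies on an edge: `none ↦ 0`, `some _ ↦ 1`. -/
def edgeCount : Option κ → ℕ
  | none => 0
  | some _ => 1

/-- A tree is a single leaf. -/
def isLeaf : HTree κ → Bool
  | leaf _ => true
  | node _ _ _ _ => false

/-- An edge label fits its subtree when the subtree enters through a homotopy iff it is not a
leaf (leaves enter the products bare, composite subtrees through `h`). -/
def fits : Option κ → HTree κ → Bool
  | none, leaf _ => true
  | some _, node _ _ _ _ => true
  | _, _ => false

/-- FULL HPL trees: every edge label fits (the trees of the `m_N` formula). -/
def full : HTree κ → Bool
  | leaf _ => true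
  | node l hl r hr => full l && fits hl l && full r && fits hr r

/-- Number of leaves (`N`). -/
def leaves : HTree κ → ℕ
  | leaf _ => 1
  | node l _ r _ => leaves l + leaves r

/-- Number of internal (product) nodes. -/
def inner : HTree κ → ℕ
  | leaf _ => 0
  | node l _ r _ => inner l + inner r + 1

/-- Total number of homotopies. -/
def hCount : HTree κ → ℕ
  | leaf _ => 0
  | node l hl r hr => hCount l + edgeCount hl + (hCount r + edgeCount hr)

/-- Sum of the leaves' slot-degree vectors (`D` in the cell's notation). -/
def leafSum : HTree κ → (κ → ℤ)
  | leaf t => t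
  | node l _ r _ => leafSum l + leafSum r

variable [DecidableEq κ]

/-- The slot-degree shift of an edge label: `none ↦ 0`, `some k ↦ e_k`. -/
def shift : Option κ → (κ → ℤ)
  | none => 0
  | some k => Pi.single k 1

/-- Output slot degrees: products ADD, a homotopy acting in slot `k` SUBTRACTS `e_k`. -/
def deg : HTree κ → (κ → ℤ)
  | leaf t => t
  | node l hl r hr => (deg l - shift hl) + (deg r - shift hr)

/-- Number of homotopies per slot (`n_k`). -/
def hVec : HTree κ → (κ → ℤ)
  | leaf _ => 0
  | node l hl r hr => (hVec l + shift hl) + (hVec r + shift hr)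

/-- **Degree law.** Output slot degrees = sum of the leaf slot degrees − homotopies per slot. -/
theorem deg_eq (T : HTree κ) : deg T = leafSum T - hVec T := by
  induction T with
  | leaf t => simp [deg, leafSum, hVec]
  | node l hl r hr ihl ihr =>
    simp only [deg, leafSum, hVec, ihl, ihr]
    abel

/-- The shift of an edge label is componentwise non-negative. -/
theorem shift_nonneg (o : Option κ) (k : κ) : 0 ≤ shift o k := by
  cases o with
  | none => simp [shift]
  | some j => by_cases h : k = j <;> simp [shift, h]

/-- Homotopy counts per slot are non-negative. -/
theorem hVec_nonneg (T : HTree κ) (k : κ) : 0 ≤ hVec T k := by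
  induction T with
  | leaf t => simp [hVec]
  | node l hl r hr ihl ihr =>
    simp only [hVec, Pi.add_apply]
    have := shift_nonneg hl k
    have := shift_nonneg hr k
    linarith

/-- **Degree availability** (the LOOP-DEG test): in every slot the output degree is at most the
sum of the leaves' degrees in that slot, `c_k ≤ D_k`. -/
theorem deg_le_leafSum (T : HTree κ) (k : κ) : deg T k ≤ leafSum T k := by
  have h := congrFun (deg_eq T) k
  simp only [Pi.sub_apply] at h
  have := hVec_nonneg T k
  linarith

/-- The shifts of an edge label sum over the slots to its homotopy count. -/
theorem sum_shift [Fintype κ] (o : Option κ) : ∑ k, shift o k = (edgeCount o : ℤ) := by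
  cases o with
  | none => simp [shift, edgeCount]
  | some j => simp [shift, edgeCount]

/-- The total number of homotopies is the sum over slots of the per-slot counts. -/
theorem sum_hVec [Fintype κ] (T : HTree κ) : ∑ k, hVec T k = (hCount T : ℤ) := by
  induction T with
  | leaf t => simp [hVec, hCount]
  | node l hl r hr ihl ihr =>
    simp only [hVec, Pi.add_apply, Finset.sum_add_distrib, ihl, ihr, sum_shift, hCount]
    push_cast
    ring

omit [DecidableEq κ] in
/-- Products number one less than leaves. -/
theorem inner_add_one (T : HTree κ) : inner T + 1 = leaves T := by
  induction T with
  | leaf t => simp [inner, leaves]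
  | node l hl r hr ihl ihr => simp only [inner, leaves]; omega

omit [DecidableEq κ] in
/-- A subtree entering bare is a leaf: no products, no homotopies inside. -/
theorem eq_zero_of_fits_none {S : HTree κ} (h : fits none S = true) :
    inner S = 0 ∧ hCount S = 0 := by
  cases S with
  | leaf t => simp [inner, hCount]
  | node l hl r hr => simp [fits] at h

omit [DecidableEq κ] in
/-- A subtree entering through a homotopy is not a leaf. -/
theorem isLeaf_of_fits_some {S : HTree κ} {k : κ} (h : fits (some k) S = true) :
    S.isLeaf = false := by
  cases S with
  | leaf t => simp [fits] at h
  | node l hl r hr => simp [isLeaf]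

omit [DecidableEq κ] in
/-- In a FULL tree that is not a leaf the homotopies number one less than the products (every
product except the root feeds exactly one homotopy). -/
theorem hCount_add_one (T : HTree κ) (hT : T.full = true) (hN : T.isLeaf = false) :
    hCount T + 1 = inner T := by
  induction T with
  | leaf t => simp [isLeaf] at hN
  | node l hl r hr ihl ihr =>
    simp only [full, Bool.and_eq_true] at hT
    obtain ⟨⟨⟨hfl, hfitl⟩, hfr⟩, hfitr⟩ := hT
    simp only [hCount, inner]
    cases hl with
    | none =>
      obtain ⟨il, cl⟩ := eq_zero_of_fits_none hfitl
      cases hr with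
      | none =>
        obtain ⟨ir, cr⟩ := eq_zero_of_fits_none hfitr
        simp [edgeCount, il, cl, ir, cr]
      | some kr =>
        have h2 := ihr hfr (isLeaf_of_fits_some hfitr)
        simp only [edgeCount, il, cl]
        omega
    | some kl =>
      have h1 := ihl hfl (isLeaf_of_fits_some hfitl)
      cases hr with
      | none =>
        obtain ⟨ir, cr⟩ := eq_zero_of_fits_none hfitr
        simp only [edgeCount, ir, cr]
        omega
      | some kr =>
        have h2 := ihr hfr (isLeaf_of_fits_some hfitr)
        simp only [edgeCount]
        omega

omit [DecidableEq κ] in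
/-- **`N − 2` homotopies**: a full HPL tree which is not a single leaf has exactly `N − 2`
homotopies, `N` its number of leaves. -/
theorem hCount_add_two (T : HTree κ) (hT : T.full = true) (hN : T.isLeaf = false) :
    hCount T + 2 = leaves T := by
  have h1 := hCount_add_one T hT hN
  have h2 := inner_add_one T
  omega

/-- **Total degree.** For a full HPL tree with `N ≥ 2` leaves, `∑ₖ cₖ = ∑ₖ Dₖ − (N − 2)`. -/
theorem totalDeg_eq [Fintype κ] (T : HTree κ) (hT : T.full = true) (hN : T.isLeaf = false) :
    ∑ k, deg T k = ∑ k, leafSum T k - ((leaves T : ℤ) - 2) := by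
  have h2 := hCount_add_two T hT hN
  have hc : (hCount T : ℤ) = (leaves T : ℤ) - 2 := by
    have : ((hCount T + 2 : ℕ) : ℤ) = (leaves T : ℤ) := by exact_mod_cast h2
    push_cast at this
    linarith
  simp only [deg_eq T, Pi.sub_apply, Finset.sum_sub_distrib, sum_hVec T, hc]

/-- **Loop words land in total degree `2`.** If the leaves' total degrees add up to the number of
leaves (`∑ₖ Dₖ = N`: along a closed walk the degree offsets return), the output of a full HPL tree
has total Künneth degree `2` — it lies in `H²(𝒪_A) = ⊕_{|c| = 2} H^c`. -/
theorem totalDeg_eq_two_of_loop [Fintype κ] (T : HTree κ) (hT : T.full = true)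
    (hN : T.isLeaf = false) (hloop : ∑ k, leafSum T k = (leaves T : ℤ)) :
    ∑ k, deg T k = 2 := by
  rw [totalDeg_eq T hT hN, hloop]
  ring

end HTree

end KunnethDegreeLaw

end Summit.Ventures.HSemireg
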